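import Mathlib.AlgebraicGeometry.Morphisms.Smooth
import Mathlib.AlgebraicGeometry.Morphisms.Separated
import Mathlib.AlgebraicGeometry.Morphisms.QuasiCompact
import Mathlib.AlgebraicGeometry.IdealSheaf.Functorial
import Literature.AlgebraicGeometry.Resolution.WeightedResolutionDatum
import HarnessLib

/-!
# Route `WeightedInvariant`, crux `WeightedConstruction` — definitions posited by line `no-phi-rays-static-drop`

Route `ResolutionOfSingularities/WeightedInvariant`, crux `WeightedConstruction`
(stmt-ResolutionOfSingularities-0571, `∀ p prime, Nonempty (WeightedResolutionDatum p)`), line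
`no-phi-rays-static-drop` (lead c2, 2026-08-16). Two objects the line posits and one API lemma
(`stub_exceptional_point`, a registered stub of the line):

* `cobordantExceptional R U` — the **exceptional divisor** `E(U) = V(t⁻¹) ∩ B₊(U)` of the cobordant
  blow-up `B₊(U)` of the affine chart `U` along the Rees algebra `R`, as an ideal sheaf on `B₊(U)`
  (Włodarczyk, arXiv:2203.03090, Lemma 2.3.8: `J · 𝒪_{B₊} = t⁻¹ · 𝒪_{B₊}`). By Włodarczyk's Lemma 4.1.5
  (tree: `cobordantAlgebra.nonempty_quotient_span_s_equiv`, `𝒪_B/(t⁻¹) ≅ (A/(u))[u'₁, …, u'ₘ]` on a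
  weighted chart) its underlying scheme is the punctured weighted normal cone of the centre, and by
  Lemma 4.1.7 the strict transform restricted to it is the initial (weighted tangent cone) ideal of `X`.
* `StaticPreDatum p` — the datum interface `WeightedResolutionDatum p` with the drop axiom `(iv)`
  REPLACED by two static axioms: `(R)` restriction monotonicity of `inv` along smooth, locally
  principal, `X`-regular closed subschemes (Włodarczyk §4.2, property (3) "Restriction" of his
  invariant; consistent with `(ii)` since `𝒪/h` regular with `h` a non-zero-divisor forces `𝒪`
  regular), and `(CI)` the CONE DROP: on the exceptional-divisor pair `(E(U), X'|_{E(U)})` of every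
  chart open of its own centre `inv` is strictly below `max_Y inv` ("no Φ-ray", the static form of
  Thm. 4.3.1). The line's theorem `StaticPreDatum p → ChartPreDatum p` (hence `→ WeightedResolutionDatum p`)
  is in `Theorems/WeightedInvariantWeightedConstructionStaticReduction.lean` (lead file, lands when its
  stubs land); the transfer `∀ p prime, Nonempty (StaticPreDatum p)` is the line's crux-facing stub.
-/

noncomputable section

open CategoryTheory AlgebraicGeometry TopologicalSpace
open Literature.AlgebraicGeometry.Resolution

set_option linter.dupNamespace false -- mandated namespace of this single-conjunct summit

namespace Summit.ResolutionOfSingularities.ResolutionOfSingularities.Theorems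

universe u

/-! ## The exceptional divisor of a cobordant chart, as an ideal sheaf on `B₊(U)` -/

/-- The **exceptional divisor** `E(U) = V(t⁻¹) ∩ B₊(U)` of the cobordant blow-up of the affine chart
`U` along the Rees algebra `R`, as an ideal sheaf on `B₊(U)`: the pull-back along `B₊(U) ↪ B(U)` of the
ideal sheaf of `(t⁻¹)` (Włodarczyk, arXiv:2203.03090, Lemma 2.3.8: `J · 𝒪_{B₊} = t⁻¹ 𝒪_{B₊}`; its
underlying scheme is the punctured weighted normal cone of the centre, Lemma 4.1.5).
[cite: Wlodarczyk2022, Lemma 2.3.8 and Lemma 4.1.5] -/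
def cobordantExceptional {Y : Scheme.{u}} (R : ReesAlgebraData Y) (U : Y.affineOpens) :
    (R.cobordantPlus U).IdealSheafData :=
  (affineCobordantBlowup.exceptional (R.chartIdeals U)).comap
    (affineCobordantBlowup.plusOpens (R.chartIdeals U)).ι

/-- **Points of `V(t⁻¹) ∩ B₊(U)` are points of `E(U)`** (registered stub `stub_exceptional_point` of
line `no-phi-rays-static-drop`): a point of `B₊(U)` whose image in `B(U)` lies on `V(t⁻¹)` is the image of
a point of the closed subscheme `E(U)`. [folklore] -/
theorem stub_exceptional_point :
    ∀ ⦃Y : Scheme.{0}⦄ (R : ReesAlgebraData Y) (U : Y.affineOpens) (b : R.cobordantPlus U),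
      (affineCobordantBlowup.plusOpens (R.chartIdeals U)).ι b ∈
        ((affineCobordantBlowup.exceptional (R.chartIdeals U)).support :
          Set (affineCobordantBlowup (R.chartIdeals U))) →
      ∃ e : (cobordantExceptional R U).subscheme, (cobordantExceptional R U).subschemeι e = b := by
  intro Y R U b hb
  have hmem : b ∈ ((cobordantExceptional R U).support : Set (R.cobordantPlus U)) := by
    rw [cobordantExceptional, Scheme.IdealSheafData.support_comap]
    exact hb
  rw [← Scheme.IdealSheafData.range_subschemeι] at hmem
  exact hmem

/-! ## Static pre-data -/

/-- A **static pre-datum** in characteristic `p` (line `no-phi-rays-static-drop`): the data and axioms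
`(usc)`, `(i)`, `(ii)`, `(iii)` of `WeightedResolutionDatum p` verbatim, and INSTEAD of the drop axiom
`(iv)` the two static axioms `(R)` (restriction monotonicity of `inv` along smooth, locally principal,
`X`-regular closed subschemes) and `(CI)` (on the exceptional-divisor pair `(E(U), X'|_{E(U)})` of every
chart open of its own centre — the punctured weighted normal cone with the initial ideal, Włodarczyk
Lemmas 4.1.5/4.1.7 — `inv` is strictly below `max_Y inv`). Shape of Włodarczyk, arXiv:2203.03090,
§4.2 (properties of the invariant) and Thm. 4.3.1. -/
structure StaticPreDatum (p : ℕ) : Type 1 where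
  /-- the value set of the invariant (one for all dimensions) -/
  Γ : Type
  /-- `Γ` is linearly ordered … -/
  [linearOrder : LinearOrder Γ]
  /-- … and well-ordered -/
  [wellFoundedLT : WellFoundedLT Γ]
  /-- the invariant (total) -/
  inv : ∀ ⦃k : Type⦄ [Field k] ⦃Y : Scheme.{0}⦄, (Y ⟶ Spec (.of k)) → Y.IdealSheafData → Y → Γ
  /-- the weighted centre (total) -/
  centre : ∀ ⦃k : Type⦄ [Field k] ⦃Y : Scheme.{0}⦄, (Y ⟶ Spec (.of k)) → Y.IdealSheafData →
    ReesAlgebraData Y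
  /-- `(usc)` -/
  isClosed_superlevel : ∀ ⦃k : Type⦄ [Field k] [CharP k p] [PerfectField k] ⦃Y : Scheme.{0}⦄
    (f : Y ⟶ Spec (.of k)) [Smooth f] [IsSeparated f] [QuasiCompact f] (X : Y.IdealSheafData)
    (γ : Γ), IsClosed {y : Y | γ ≤ inv f X y}
  /-- `(i)` for `inv`, smooth `k`-morphisms -/
  inv_comap : ∀ ⦃k : Type⦄ [Field k] [CharP k p] [PerfectField k] ⦃Y Y₁ : Scheme.{0}⦄
    (f : Y ⟶ Spec (.of k)) [Smooth f] [IsSeparated f] [QuasiCompact f]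
    (f₁ : Y₁ ⟶ Spec (.of k)) [Smooth f₁] [IsSeparated f₁] [QuasiCompact f₁]
    (g : Y₁ ⟶ Y) [Smooth g], g ≫ f = f₁ →
    ∀ (X : Y.IdealSheafData) (y₁ : Y₁), inv f₁ (X.comap g) y₁ = inv f X (g y₁)
  /-- `(i)` for `inv`, perfect ground-field extensions -/
  inv_baseChange : ∀ ⦃k : Type⦄ [Field k] [CharP k p] [PerfectField k]
    ⦃K : Type⦄ [Field K] [PerfectField K] (φ : k →+* K)
    ⦃Y YK : Scheme.{0}⦄ (f : Y ⟶ Spec (.of k)) [Smooth f] [IsSeparated f] [QuasiCompact f]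
    (fK : YK ⟶ Spec (.of K)) (pr : YK ⟶ Y),
    IsPullback pr fK f (Spec.map (CommRingCat.ofHom φ)) →
    ∀ (X : Y.IdealSheafData) (y : YK), inv fK (X.comap pr) y = inv f X (pr y)
  /-- `(ii)` -/
  isBot_inv_iff : ∀ ⦃k : Type⦄ [Field k] [CharP k p] [PerfectField k] ⦃Y : Scheme.{0}⦄
    (f : Y ⟶ Spec (.of k)) [Smooth f] [IsSeparated f] [QuasiCompact f] (X : Y.IdealSheafData)
    (y : Y), IsBot (inv f X y) ↔
      ∀ x : X.subscheme, X.subschemeι x = y → IsRegularLocalRing (X.subscheme.presheaf.stalk x)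
  /-- `(iii)` regular weighted centre -/
  isRegularWeightedCentre_centre : ∀ ⦃k : Type⦄ [Field k] [CharP k p] [PerfectField k]
    ⦃Y : Scheme.{0}⦄ (f : Y ⟶ Spec (.of k)) [Smooth f] [IsSeparated f] [QuasiCompact f]
    (X : Y.IdealSheafData), (∃ y : Y, ¬ IsBot (inv f X y)) →
    (centre f X).IsRegularWeightedCentre
  /-- `(iii)` support = maximum locus -/
  support_centre : ∀ ⦃k : Type⦄ [Field k] [CharP k p] [PerfectField k]
    ⦃Y : Scheme.{0}⦄ (f : Y ⟶ Spec (.of k)) [Smooth f] [IsSeparated f] [QuasiCompact f]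
    (X : Y.IdealSheafData), (∃ y : Y, ¬ IsBot (inv f X y)) →
    (centre f X).support = {y : Y | ∀ y' : Y, inv f X y' ≤ inv f X y}
  /-- `(i)` for the centre, smooth surjective `k`-morphisms -/
  centre_comap : ∀ ⦃k : Type⦄ [Field k] [CharP k p] [PerfectField k] ⦃Y Y₁ : Scheme.{0}⦄
    (f : Y ⟶ Spec (.of k)) [Smooth f] [IsSeparated f] [QuasiCompact f]
    (f₁ : Y₁ ⟶ Spec (.of k)) [Smooth f₁] [IsSeparated f₁] [QuasiCompact f₁]
    (g : Y₁ ⟶ Y) [Smooth g] [Surjective g], g ≫ f = f₁ →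
    ∀ (X : Y.IdealSheafData), (∃ y : Y, ¬ IsBot (inv f X y)) →
    ∀ n : ℕ, (centre f₁ (X.comap g)).piece n = ((centre f X).piece n).comap g
  /-- `(i)` for the centre, perfect ground-field extensions -/
  centre_baseChange : ∀ ⦃k : Type⦄ [Field k] [CharP k p] [PerfectField k]
    ⦃K : Type⦄ [Field K] [PerfectField K] (φ : k →+* K)
    ⦃Y YK : Scheme.{0}⦄ (f : Y ⟶ Spec (.of k)) [Smooth f] [IsSeparated f] [QuasiCompact f]
    (fK : YK ⟶ Spec (.of K)) (pr : YK ⟶ Y),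
    IsPullback pr fK f (Spec.map (CommRingCat.ofHom φ)) →
    ∀ (X : Y.IdealSheafData), (∃ y : Y, ¬ IsBot (inv f X y)) →
    ∀ n : ℕ, (centre fK (X.comap pr)).piece n = ((centre f X).piece n).comap pr

  /-- `(R)` RESTRICTION: for a closed subscheme `H` of `Y` (an ideal sheaf) with `H → Spec k` smooth
  that is, near each of its points, principal on some affine open with an `X`-regular generator,
  `inv (Y, X) ≤ inv (H, X|_H)` at every point of `H` -/
  inv_le_restrict : ∀ ⦃k : Type⦄ [Field k] [CharP k p] [PerfectField k] ⦃Y : Scheme.{0}⦄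
    (f : Y ⟶ Spec (.of k)) [Smooth f] [IsSeparated f] [QuasiCompact f]
    (X H : Y.IdealSheafData), Smooth (H.subschemeι ≫ f) →
    (∀ x : H.subscheme, ∃ V : Y.affineOpens, H.subschemeι x ∈ (V : Y.Opens) ∧
      ∃ h : Γ(Y, V), H.ideal V = Ideal.span {h} ∧
        ∀ a : Γ(Y, V), h * a ∈ X.ideal V → a ∈ X.ideal V) →
    ∀ x : H.subscheme, inv f X (H.subschemeι x) ≤ inv (H.subschemeι ≫ f) (X.comap H.subschemeι) x
  /-- `(CI)` CONE DROP [guard]: for every affine open `U` carrying a weighted chart of the centre, with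
  `B₊(U) → Spec k` and `E(U) → Spec k` smooth, separated and quasi-compact available, at every point
  `e` of the exceptional divisor `E(U)` the invariant of `(E(U), X'|_{E(U)})` is strictly below
  `max_Y inv` -/
  inv_exceptional_lt : ∀ ⦃k : Type⦄ [Field k] [CharP k p] [PerfectField k]
    ⦃Y : Scheme.{0}⦄ (f : Y ⟶ Spec (.of k)) [Smooth f] [IsSeparated f] [QuasiCompact f]
    (X : Y.IdealSheafData), (∃ y : Y, ¬ IsBot (inv f X y)) →
    ∀ (U : Y.affineOpens),
      (∃ (m : ℕ) (u : Fin m → Γ(Y, U)) (w : Fin m → ℕ), (centre f X).IsWeightedChart U u w) →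
      Smooth ((centre f X).cobordantPlusι U ≫ f) →
      IsSeparated ((centre f X).cobordantPlusι U ≫ f) →
      QuasiCompact ((centre f X).cobordantPlusι U ≫ f) →
      Smooth ((cobordantExceptional (centre f X) U).subschemeι ≫ (centre f X).cobordantPlusι U ≫ f) →
      IsSeparated ((cobordantExceptional (centre f X) U).subschemeι ≫ (centre f X).cobordantPlusι U ≫ f) →
      QuasiCompact ((cobordantExceptional (centre f X) U).subschemeι ≫ (centre f X).cobordantPlusι U ≫ f) →
      ∀ (e : (cobordantExceptional (centre f X) U).subscheme) (y : Y),
        (∀ y' : Y, inv f X y' ≤ inv f X y) →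
        inv ((cobordantExceptional (centre f X) U).subschemeι ≫ (centre f X).cobordantPlusι U ≫ f)
          (((centre f X).cobordantStrictTransform U X).comap
            (cobordantExceptional (centre f X) U).subschemeι) e
          < inv f X y

namespace StaticPreDatum

variable {p : ℕ} (S : StaticPreDatum p)

/-- The value set of a static pre-datum is linearly ordered. -/
instance instLinearOrder : LinearOrder S.Γ := S.linearOrder

/-- The value set of a static pre-datum is well-ordered. -/
instance instWellFoundedLT : WellFoundedLT S.Γ := S.wellFoundedLT

end StaticPreDatum

end Summit.ResolutionOfSingularities.ResolutionOfSingularities.Theorems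

end
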